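/-
Origin: expansion seat `prover-pub-hodgecm-mc-binder-2-g14-0`, handover #81 2026-08-20T13:55Z md5 4cb32bf477d0 (NEW; 136 l.; THE INSERTED PRINTED VACUUM AS ONE FOLLAND LETTER — adapter asked by binder-1-g13 l.13487 / theta-3-g16 l.13463: `vacFam` (abbrev, `b ↦ φ⁰_b`), `printPlaces_φ₀_eq_tprod` (rfl), `placePoly_vacFam`, `ins_φ₀` (ANY datum family: `ins f φ₀ = 𝓕⁻¹(follandFock 𝔢 (∏_w rename (atPlace w) (rename idx_w (kindVacPoly kind_w))) ⊗ f)`), `prod_vacuumPoly_datumAtσ` (census data, ANY twist σ: product = `rename (atPlace (cmPlace ι₁)) (rename (jIAt …) detZ)`), `ins_φ₀_datumAtσ` (combined); complements theta-3's (K15) `ArchSideTerm.insPoly_printedAt_φ₀` (raw `insPoly` level, σ = 1) at the `ins` level and for every σ; CERT private mirror = PKG RUN-50 `.lake` farm ⊕ S5b rows: rc 0 / 0 warn / 0 proof-hole / 15.9 s, default heartbeats; `#print axioms` 3/3 ⊆ trio (`g14/certs/axioms-81.log`); FQN 0 collisions vs PKG and vs (K15)'s 19 names (different namespace + names); 1 abbrev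 (data) / 0 Prop-defs / 0 records; NAME LIST: HodgeCM.Model.HypCensus.ins_φ₀_datumAtσ · HodgeCM.Model.HypCensus.prod_vacuumPoly_datumAtσ · HodgeCM.Model.HypCensus.ins_φ₀) (`HOME/mc/pub-hodgecm-mc-binder-2/g14/pkg52/HodgeCM/Model/HypCensus/InsVacuumPoly.lean`, md5 4cb32bf477d0, 136 lines);
landed by the second packager p2 gen 8 (p2-g8) in gate run 52 as `HodgeCM/Model/HypCensus/InsVacuumPoly.lean` (verbatim).
-/
/-
Origin: speedrun cell pub-hodgecm, MODEL-CONSTRUCTION sub-cell, lineage mc-binder-2 (BINDER-OWNERS rows 18/19: E binders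
`hyp12`/`hyp34`), seat `prover-pub-hodgecm-mc-binder-2-g14-0`, gen 14; adapter leaf for binder-1's row 17 `harch` / theta-3's (A″).
-/
import Summits.HodgeConjecture.HodgeCM.Model.HypCensus.OmgInsVacuum
import Summits.HodgeConjecture.HodgeCM.Model.HypCensus.OmgInsPinChoice

/-!
# The inserted printed VACUUM as ONE Folland letter

KERNEL ONLY (0 records, 0 `def … : Prop`, nothing cited).  The adapter asked for by binder-1-g13 (STATUS 13:17Z) and theta-3-g16 (12:55Z):
the census insertion of the printed vacuum `φ₀ = ⊗_b φ⁰_b` unfolded to polynomial currency.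

* `printPlaces_φ₀_eq_tprod` — `(printPlaces …).φ₀ = ⨂ₜ_b (loc b).φ` (definitional);
* **`ins_φ₀`** — for ANY place-datum family: `ins f φ₀ = 𝓕⁻¹(follandFock 𝔢 (∏_w rename (atPlace w) (rename idx_w (kindVacPoly kind_w))) ⊗ f)`
  (`ins_tprod` + `placePoly_vacuum`; `kindVacPoly = 1 ∕ 1 ∕ detZ ∕ 1` at `sigma ∕ delta ∕ iota ∕ sigmaSwap`);
* **`prod_vacuumPoly_datumAtσ`** — for the CENSUS data `datumAtσ V S jD (jIOf V S hW) σ` (ANY torus twist `σ`, so for the `jT₁₂` census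
  `datumAt = datumAtσ 1` and the (B1′) census `σ := sigma34 S` alike): the product collapses to the `ι₁` determinant letter
  `rename (atPlace (cmPlace ι₁)) (rename jIAt detZ)` — every `Σ₁₂` / `D₁₂` place contributes `1`;
* **`ins_φ₀_datumAtσ`** — the two combined: `ins f φ₀ = 𝓕⁻¹(follandFock 𝔢 (rename (atPlace (cmPlace ι₁)) (rename jIAt detZ)) ⊗ f)`.
-/

noncomputable section

open NumberField NumberField.InfinitePlace
open scoped Classical TensorProduct
open MvPolynomial
open Literature.NumberTheory.Automorphic Literature.NumberTheory.Automorphic.UnitaryGroup Literature.NumberTheory.Weil1964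
open Literature.RepresentationTheory.KonnoKonno2007 Literature.RepresentationTheory.KonnoKonno2007.RealDualPair
open Literature.NumberTheory.GelbartRogawski1991 Literature.NumberTheory.GelbartRogawski1991.UnitaryDualPair
open Literature.RepresentationTheory (atPlace)
open Literature.Analysis.SegalBargmann
open HodgeCM HodgeCM.Model HodgeCM.Adelic
open HodgeCM.PerL34.Fock HodgeCM.PerL34.Fock.PrintDict

namespace HodgeCM.Model.HypCensus

/-! ## §1 Any place-datum family -/

section Generic

variable (L : Type) [Field L] [NumberField L] [IsCMField L]
variable (dV : Fin 3 → L) (hdV : ∀ i, IsCMField.complexConj L (dV i) = dV i) (hdV0 : ∀ i, dV i ≠ 0)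
variable (dW : Fin 2 → L) (hdW : ∀ i, IsCMField.complexConj L (dW i) = dW i) (hdW0 : ∀ i, dW i ≠ 0)
variable (ι₁ : L →+* ℂ)
variable (datum : ∀ b : InfinitePlace L, PlaceDatum L dV hdV dW hdW ι₁ (cmPlacesEquiv L b)) (m₁ m₂ : InfinitePlace L → ℤ)

/-- the family of the local printed vacua `b ↦ φ⁰_b` (so that `φ₀ = ⨂ₜ vacFam`, definitional — `Fock.FockPlaces.φ₀`). -/
abbrev vacFam (b : InfinitePlace L) :
    ((printPlaces (InfinitePlace L) (kindOf L dV hdV dW hdW ι₁ datum) (lamOf L dV hdV dW hdW ι₁ datum)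
      (lamOf_ne_zero L dV hdV dW hdW ι₁ datum) (pinnedVacs (kindOf L dV hdV dW hdW ι₁ datum) m₁ m₂)).loc b).M :=
  ((printPlaces (InfinitePlace L) (kindOf L dV hdV dW hdW ι₁ datum) (lamOf L dV hdV dW hdW ι₁ datum)
    (lamOf_ne_zero L dV hdV dW hdW ι₁ datum) (pinnedVacs (kindOf L dV hdV dW hdW ι₁ datum) m₁ m₂)).loc b).φ

/-- the printed vacuum is the pure tensor of the local vacua (definitional). -/
theorem printPlaces_φ₀_eq_tprod :
    (printPlaces (InfinitePlace L) (kindOf L dV hdV dW hdW ι₁ datum) (lamOf L dV hdV dW hdW ι₁ datum)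
        (lamOf_ne_zero L dV hdV dW hdW ι₁ datum) (pinnedVacs (kindOf L dV hdV dW hdW ι₁ datum) m₁ m₂)).φ₀ =
      PiTensorProduct.tprod ℂ (vacFam L dV hdV dW hdW ι₁ datum m₁ m₂) :=
  rfl

/-- the place polynomial of the vacuum family at the real place `w` (= `placePoly_vacuum`, in the `vacFam` spelling). -/
theorem placePoly_vacFam (w : {v : InfinitePlace ↥(maximalRealSubfield L) // v.IsReal}) :
    placePoly L dV hdV dW hdW ι₁ datum m₁ m₂ (vacFam L dV hdV dW hdW ι₁ datum m₁ m₂) w =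
      rename (datum ((cmPlacesEquiv L).symm w)).idx (kindVacPoly (datum ((cmPlacesEquiv L).symm w)).kind) :=
  placePoly_vacuum L dV hdV dW hdW ι₁ datum m₁ m₂ w

/-- **the inserted printed VACUUM as one Folland letter** (any data): the place product of the renamed vacuum polynomials
`kindVacPoly` (`1` at `Σ₁₂`/`D₁₂`/swapped-`Σ₁₂` places, `det z` at `ι₁`). -/
theorem ins_φ₀ (f : FinSB ↥(maximalRealSubfield L) (Fin 6)) :
    ins L dV hdV hdV0 dW hdW hdW0 ι₁ datum m₁ m₂ f
        (printPlaces (InfinitePlace L) (kindOf L dV hdV dW hdW ι₁ datum) (lamOf L dV hdV dW hdW ι₁ datum)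
          (lamOf_ne_zero L dV hdV dW hdW ι₁ datum) (pinnedVacs (kindOf L dV hdV dW hdW ι₁ datum) m₁ m₂)).φ₀ =
      piSchwartzBruhatEquiv ↥(maximalRealSubfield L) (Fin 6)
        (follandFock (cmBigFrame L finProdFinEquiv dV hdV hdV0 dW hdW hdW0 ι₁)
          (∏ w, rename (atPlace w) (rename (datum ((cmPlacesEquiv L).symm w)).idx
            (kindVacPoly (datum ((cmPlacesEquiv L).symm w)).kind))) ⊗ₜ f) := by
  have h2 := ins_tprod L dV hdV hdV0 dW hdW hdW0 ι₁ datum m₁ m₂ f (vacFam L dV hdV dW hdW ι₁ datum m₁ m₂)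
  have h3 : (∏ w, rename (atPlace w) (placePoly L dV hdV dW hdW ι₁ datum m₁ m₂ (vacFam L dV hdV dW hdW ι₁ datum m₁ m₂) w)) =
      ∏ w, rename (atPlace w) (rename (datum ((cmPlacesEquiv L).symm w)).idx
        (kindVacPoly (datum ((cmPlacesEquiv L).symm w)).kind)) :=
    Finset.prod_congr rfl fun w _ => by rw [placePoly_vacFam]
  rw [h3] at h2
  exact h2

end Generic

/-! ## §2 The census data: only the `ι₁` determinant survives -/

section Census

variable {L : CMField} {ι₁ : L →+* ℂ} (V : HermSpace3 L ι₁) (S : StubTree.SeesawDatum L)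
variable (hW : (∀ j, 0 < (ι₁ ((dW S) j)).re) ∨ ∀ j, (ι₁ ((dW S) j)).re < 0)
variable (jD : InfinitePlace (L : Type) → HodgeCM.PerL34.Fock.EqVar → Fin 6) (m₁ m₂ : InfinitePlace (L : Type) → ℤ)
variable {σ : InfinitePlace (L : Type) → Equiv.Perm (Fin 2)}

/-- **for the census data the vacuum letter is the `ι₁` determinant alone** (any torus twist `σ`): every place other than the one
under `ι₁` is of kind `≠ ι₁` (`datumAt_kind_ne_iota_of_ne`), where `kindVacPoly = 1`; at `ι₁` the datum is `iota jIAt` (`datumAt_of_eq`,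
`jIOf`), whose vacuum polynomial is `det z` read through `jIAt`. -/
theorem prod_vacuumPoly_datumAtσ :
    ∏ w, rename (atPlace w) (rename ((datumAtσ V S jD (jIOf V S hW) σ) ((cmPlacesEquiv (L : Type)).symm w)).idx
        (kindVacPoly ((datumAtσ V S jD (jIOf V S hW) σ) ((cmPlacesEquiv (L : Type)).symm w)).kind)) =
      rename (atPlace (cmPlace (L : Type) ι₁))
        (rename (jIAt (L : Type) (frameD V) (frameD_real V) (dW S) (dW_real S) ι₁ (frameD_sign_ι₁ V) hW) HodgeCM.PerL34.Fock.detZ) := by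
  rw [Finset.prod_eq_single (cmPlace (L : Type) ι₁)]
  · rw [datumAt_of_eq V S jD (jIOf V S hW) (σ := σ) ((cmPlacesEquiv (L : Type)).symm (cmPlace (L : Type) ι₁))
      (Equiv.apply_symm_apply _ _)]
    rfl
  · intro w _ hw
    have hk : ((datumAtσ V S jD (jIOf V S hW) σ) ((cmPlacesEquiv (L : Type)).symm w)).kind ≠ .iota :=
      datumAt_kind_ne_iota_of_ne V S jD (jIOf V S hW) ((cmPlacesEquiv (L : Type)).symm w)
        (by rw [Equiv.apply_symm_apply]; exact hw)
    rw [kindVacPoly_of_ne_iota hk, map_one, map_one]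
  · intro h
    exact absurd (Finset.mem_univ _) h

/-- **the inserted printed VACUUM of the census data** (any twist `σ`; `σ = 1` is the `jT₁₂` census `datumAt`, `σ = sigma34 S` the (34) one):
`ins f φ₀ = 𝓕⁻¹(follandFock 𝔢 (rename (atPlace (cmPlace ι₁)) (rename jIAt (det z))) ⊗ f)`. -/
theorem ins_φ₀_datumAtσ (f : FinSB ↥(maximalRealSubfield L) (Fin 6)) :
    ins (L : Type) (frameD V) (frameD_real V) (frameD_ne V) (dW S) (dW_real S) (dW_ne S) ι₁ (datumAtσ V S jD (jIOf V S hW) σ) m₁ m₂ f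
        (printPlaces (InfinitePlace (L : Type))
          (kindOf (L : Type) (frameD V) (frameD_real V) (dW S) (dW_real S) ι₁ (datumAtσ V S jD (jIOf V S hW) σ))
          (lamOf (L : Type) (frameD V) (frameD_real V) (dW S) (dW_real S) ι₁ (datumAtσ V S jD (jIOf V S hW) σ))
          (lamOf_ne_zero (L : Type) (frameD V) (frameD_real V) (dW S) (dW_real S) ι₁ (datumAtσ V S jD (jIOf V S hW) σ))
          (pinnedVacs (kindOf (L : Type) (frameD V) (frameD_real V) (dW S) (dW_real S) ι₁ (datumAtσ V S jD (jIOf V S hW) σ)) m₁ m₂)).φ₀ =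
      piSchwartzBruhatEquiv ↥(maximalRealSubfield L) (Fin 6)
        (follandFock (cmBigFrame (L : Type) finProdFinEquiv (frameD V) (frameD_real V) (frameD_ne V) (dW S) (dW_real S) (dW_ne S) ι₁)
          (rename (atPlace (cmPlace (L : Type) ι₁))
            (rename (jIAt (L : Type) (frameD V) (frameD_real V) (dW S) (dW_real S) ι₁ (frameD_sign_ι₁ V) hW) HodgeCM.PerL34.Fock.detZ)) ⊗ₜ f) := by
  rw [ins_φ₀, prod_vacuumPoly_datumAtσ]

end Census

end HodgeCM.Model.HypCensus

end
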